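import Summits.KontsevichZagierPeriods.KontsevichZagierPeriods.Theses.EulerFormChain

/-!
# `PolydiscRepExists` (stmt-KontsevichZagierPeriods-14239, route EulerFormChain) — proof

THE POLYDISC REPRESENTATION EXISTS IN THE KONTSEVICH–ZAGIER CALCULUS: for every `k : ℕ` and `q : ℚ`
there is an integral representation `p : KZ.IntegralRep (k * 2)` whose domain is the closed polydisc
`D̄ᵏ = {u : ℝ^{k·2} | u_{(i,0)}² + u_{(i,1)}² ≤ 1 (i < k)}` (coordinates paired by
`finProdFinEquiv : Fin k × Fin 2 ≃ Fin (k * 2)`) and whose integrand is the constant `q` on it.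

Proof (routine, no transcendence input): the record is built inside the proof.
* the domain is the finite intersection over `i : Fin k` of the non-strict polynomial inequalities
  `X_{(i,0)}² + X_{(i,1)}² ≤ 1` with rational coefficients, hence `ℚ`-semialgebraic
  (`IsSemialgebraic.biInter`, `isSemialgebraic_setOf_eval_le`);
* the integrand is the constant polynomial `C q` (`isSemialgebraicFunOn_aeval`);
* integrability: every coordinate `j = (i, b)` of a point of the polydisc has `u_j² ≤ 1`, so the
  polydisc lies in the closed unit ball of the sup norm, which has finite Lebesgue measure, and a
  constant is integrable on a set of finite measure (`integrableOn_const`).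

References: M. Kontsevich, D. Zagier, *Periods* (2001), §1.1; Bochnak–Coste–Roy (1998), §2.1.
-/

open MeasureTheory MvPolynomial Set
open Literature.NumberTheory.Transcendental Literature.ModelTheory.ExponentialFields

namespace Summit.KontsevichZagierPeriods.EulerFormChain

/-- The closed polydisc `{u | ∀ i, u_{(i,0)}² + u_{(i,1)}² ≤ 1} ⊆ ℝ^{k·2}` is `ℚ`-semialgebraic: a
finite intersection of non-strict polynomial inequalities with rational coefficients.
[cite: BochnakCosteRoy1998, §2.1] -/
theorem isSemialgebraic_polydisc (k : ℕ) :
    IsSemialgebraic ℚ {u : Fin (k * 2) → ℝ | ∀ i : Fin k,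
      u (finProdFinEquiv (i, (0 : Fin 2))) ^ 2 + u (finProdFinEquiv (i, (1 : Fin 2))) ^ 2 ≤ 1} := by
  have h := IsSemialgebraic.biInter (k := ℚ) (R := ℝ) (Finset.univ : Finset (Fin k))
    (fun i => {u : Fin (k * 2) → ℝ |
      aeval u ((X (finProdFinEquiv (i, (0 : Fin 2))) ^ 2 + X (finProdFinEquiv (i, (1 : Fin 2))) ^ 2 :
        MvPolynomial (Fin (k * 2)) ℚ)) ≤ aeval u (1 : MvPolynomial (Fin (k * 2)) ℚ)})
    fun i _ => isSemialgebraic_setOf_eval_le _ _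
  convert h using 1
  ext u
  simp

/-- The closed polydisc lies in the closed unit ball of the sup norm of `ℝ^{k·2}`: each coordinate
`j = (i, b)` of a point `u` of the polydisc satisfies `u_j² ≤ u_{(i,0)}² + u_{(i,1)}² ≤ 1`.
[folklore] -/
theorem polydisc_subset_closedBall (k : ℕ) :
    {u : Fin (k * 2) → ℝ | ∀ i : Fin k,
      u (finProdFinEquiv (i, (0 : Fin 2))) ^ 2 + u (finProdFinEquiv (i, (1 : Fin 2))) ^ 2 ≤ 1} ⊆
      Metric.closedBall (0 : Fin (k * 2) → ℝ) 1 := by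
  intro u hu
  rw [mem_closedBall_zero_iff, pi_norm_le_iff_of_nonneg zero_le_one]
  intro j
  obtain ⟨⟨i, b⟩, rfl⟩ := finProdFinEquiv.surjective j
  rw [Real.norm_eq_abs, ← sq_le_one_iff_abs_le_one]
  have hi := hu i
  have h0 := sq_nonneg (u (finProdFinEquiv (i, (0 : Fin 2))))
  have h1 := sq_nonneg (u (finProdFinEquiv (i, (1 : Fin 2))))
  revert b
  rw [Fin.forall_fin_two]
  exact ⟨by linarith, by linarith⟩

/-- **`PolydiscRepExists`** (route EulerFormChain, stmt-KontsevichZagierPeriods-14239): for every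
`k : ℕ` and `q : ℚ` there is an integral representation over the closed polydisc
`{u : ℝ^{k·2} | u_{(i,0)}² + u_{(i,1)}² ≤ 1 (i < k)}` with integrand constantly `q`. Proof: the
domain is a finite intersection of rational polynomial inequalities, the integrand is the constant
polynomial `C q`, and a constant is integrable on a subset of the closed unit sup-norm ball.
[cite: KontsevichZagier2001, §1.1] -/
theorem polydiscRepExists_proof :
    Summit.KontsevichZagierPeriods.KontsevichZagierPeriods.Theses.EulerFormChain.PolydiscRepExists := by
  intro k q
  refine ⟨⟨_, fun _ => (q : ℝ), isSemialgebraic_polydisc k, ?_, ?_⟩, rfl, fun _ _ => rfl⟩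
  · simpa using isSemialgebraicFunOn_aeval (isSemialgebraic_polydisc k)
      (C q : MvPolynomial (Fin (k * 2)) ℚ)
  · exact integrableOn_const (ne_top_of_le_ne_top measure_closedBall_lt_top.ne
      (measure_mono (polydisc_subset_closedBall k)))

end Summit.KontsevichZagierPeriods.EulerFormChain
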